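import Literature.Geometry.Kaehler.SiegelTorusThetaNullSingular
import HarnessLib

/-!
# Two-division points on the theta divisor of a decomposable p.p.a.v.: the exact count

Layer `Literature/Geometry/Kaehler`, namespace `Literature.Geometry.Kaehler.ComplexTorus` (lane
`lit-hodgefound`, Layer A4, theta-divisor row A4-17; prover seat `lit-hodgefound-p23`, row «A4-17(k)»).
Sequel of `SiegelTorusThetaDivisorSingular.lean` (`Sing Θ` of `X_{Ω₁ ⊕ Ω₂}`; "`#(X₂ ∩ Θ) > 2^{g-1}(2^g − 1)`"
for a decomposable p.p.a.v.), of `SiegelTorusThetaParity.lean` (`#X₂ = 4ⁿ`, `X₂ ≃ (ℤ/2ℤ)^{2n}` on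
generators) and of `SiegelTorusThetaNullSingular.lean` (genus one: `#(X₂ ∩ Θ) = 1`).

Sources followed (held texts, read at the quoted chunks).

* S. Grushevsky, *The Schottky problem* (MSRI Publ. 59, 2012), §5 [held `paper:arxiv-1009.0369` p0011]:
  "for a decomposable ppav `(A, Θ) = (A₁, Θ₁) × (A₂, Θ₂)` … we have `Θ = (Θ₁ × A₂) ∪ (A₁ × Θ₂)`";
  "`θ_null,g := {τ ∣ ∏_{m ∈ A[2]^even} θ_m(τ) = 0} = {(A, Θ) ∈ 𝒜_g ∣ A[2]^even ∩ Θ ≠ ∅}`". Intersected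
  with `A[2] = A₁[2] × A₂[2]` the first display reads
  `A[2] ∩ Θ = ((A₁[2] ∩ Θ₁) × A₂[2]) ∪ (A₁[2] × (A₂[2] ∩ Θ₂))`, whence by inclusion–exclusion
  `#(A[2] ∩ Θ) = a·4^{g₂} + 4^{g₁}·b − a·b` with `a = #(A₁[2] ∩ Θ₁)`, `b = #(A₂[2] ∩ Θ₂)`.
* H. Farkas, S. Grushevsky, R. Salvati Manni, *An explicit solution to the weak Schottky problem*,
  Algebr. Geom. 8 (2021), §2 [held `paper:arxiv-1710.02938` p0006] and §4 [p0011]: theta constants with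
  characteristic of a block-diagonal period matrix are the products of those of the blocks (the tree's
  `riemannThetaChar_blockDiag_zero`); here only the characteristic-free form `ϑ_Ω = ϑ_{Ω₁} ϑ_{Ω₂}`
  (`riemannTheta_blockDiag`) evaluated at half-periods is used.
* H. Lange, *Abelian Varieties over the Complex Numbers* (2023), §1.1.2 Prop. 1.1.14 [p0022]
  (`X₂ ≃ (ℤ/2ℤ)^{2g}`, the tree's `divisionPointsEquiv`) and §2.3.4 Prop. 2.3.15 (the counts `#X₂^±`).

What is here (theorems only; no definition, no named fact, net debt `0`).

* `coe_mem_thetaDivisor_blockDiag_iff_coord` — for a two-division point `x` of `X = X_{Ω₁ ⊕ Ω₂}` with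
  `(ℤ/2ℤ)^{2(n₁+n₂)}`-coordinates `p` (`divisionPointsEquiv`): `x ∈ Θ` iff the two-division point of `X₁`
  with coordinates `p|₁` lies on `Θ₁` or the one of `X₂` with coordinates `p|₂` lies on `Θ₂`
  (Grushevsky's `Θ = (Θ₁ × A₂) ∪ (A₁ × Θ₂)` on `A[2] = A₁[2] × A₂[2]`).
* **`natCard_twoTorsion_inter_thetaDivisor_blockDiag`** —
  `#(X₂ ∩ Θ) = a·4^{n₂} + 4^{n₁}·b − a·b`, `a = #(X₂(X₁) ∩ Θ₁)`, `b = #(X₂(X₂) ∩ Θ₂)`.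
* VALIDATION instances: `natCard_twoTorsion_inter_thetaDivisor_elliptic_blockDiag` — `X = E_τ × X₂'`
  (`n₁ = 1`, `a = 1`): `#(X₂ ∩ Θ) = 4^{n₂} + 3b`; `natCard_twoTorsion_inter_thetaDivisor_elliptic_prod` —
  `E_{τ₁} × E_{τ₂}`: `#(X₂ ∩ Θ) = 7` (the block-diagonal twin of `natCard_twoTorsion_inter_thetaDivisor_diagonal_fin_two`).

Not here: the split of the count into even and odd points (the odd ones number `2^{g-1}(2^g − 1)` for every
p.p.a.v., `natCard_twoTorsion_odd`); indecomposable p.p.a.v.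

## References

* [Grushevsky2012SchottkyProblem] S. Grushevsky, The Schottky problem, MSRI Publ. 59 (2012), §5.
* [FarkasGrushevskySalvatimanni2021] H. Farkas, S. Grushevsky, R. Salvati Manni, An explicit solution to
  the weak Schottky problem, Algebr. Geom. 8 (2021), §2, §4.
* [Lange2023AbelianVarietiesComplex] H. Lange, Abelian Varieties over the Complex Numbers (2023),
  §1.1.2 Prop. 1.1.14, §2.3.4 Prop. 2.3.15.
-/

noncomputable section

open scoped Manifold Topology
open Set Function Complex Matrix
open Literature.Analysis.SpecialFunctions

namespace Literature.Geometry.Kaehler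

namespace ComplexTorus

/-! ### Combinatorics: inclusion–exclusion on a product, and the block splitting of coordinates -/

section Combinatorics

/-- `#{(u, v) ∣ P u ∨ Q v} = #P · #V + #U · #Q − #P · #Q` on a product of finite types. [folklore] -/
private theorem natCard_prod_or {U V : Type*} [Fintype U] [Fintype V] (P : U → Prop) (Q : V → Prop) :
    Nat.card {uv : U × V // P uv.1 ∨ Q uv.2} =
      Nat.card {u // P u} * Fintype.card V + Fintype.card U * Nat.card {v // Q v} -
        Nat.card {u // P u} * Nat.card {v // Q v} := by
  classical
  simp only [Nat.card_eq_fintype_card, Fintype.card_subtype]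
  set s : Finset (U × V) := (Finset.univ.filter P) ×ˢ (Finset.univ : Finset V) with hs
  set t : Finset (U × V) := (Finset.univ : Finset U) ×ˢ (Finset.univ.filter Q) with ht
  have hunion : (Finset.univ.filter fun uv : U × V ↦ P uv.1 ∨ Q uv.2) = s ∪ t := by
    ext ⟨u, v⟩
    simp [hs, ht]
  have hinter : s ∩ t = (Finset.univ.filter P) ×ˢ (Finset.univ.filter Q) := by
    ext ⟨u, v⟩
    simp [hs, ht]
  have h := Finset.card_union_add_card_inter s t
  rw [← hunion, hinter, Finset.card_product, hs, ht, Finset.card_product, Finset.card_product,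
    Finset.card_univ, Finset.card_univ] at h
  exact eq_tsub_of_add_eq h

/-- The block splitting `(A ⊔ A → R) ≃ (A₁ ⊔ A₁ → R) × (A₂ ⊔ A₂ → R)` for `A = Fin (n₁ + n₂)`,
`Aᵢ = Fin nᵢ` (restriction along `Fin.castAdd` / `Fin.natAdd` on both summands). [folklore] -/
private theorem exists_blockSplit (n₁ n₂ : ℕ) (R : Type*) :
    ∃ E : ((Fin (n₁ + n₂) ⊕ Fin (n₁ + n₂)) → R) ≃ ((Fin n₁ ⊕ Fin n₁) → R) × ((Fin n₂ ⊕ Fin n₂) → R),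
      ∀ p, (E p).1 = (fun s ↦ p (Sum.map (Fin.castAdd n₂) (Fin.castAdd n₂) s)) ∧
        (E p).2 = (fun s ↦ p (Sum.map (Fin.natAdd n₁) (Fin.natAdd n₁) s)) := by
  refine ⟨(Equiv.arrowCongr ((Equiv.sumCongr finSumFinEquiv.symm finSumFinEquiv.symm).trans
      (Equiv.sumSumSumComm (Fin n₁) (Fin n₂) (Fin n₁) (Fin n₂))) (Equiv.refl R)).trans
      (Equiv.sumArrowEquivProdArrow _ _ R), fun p ↦ ⟨?_, ?_⟩⟩
  · funext s
    rcases s with i | i <;> rfl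
  · funext s
    rcases s with i | i <;> rfl

end Combinatorics

/-! ### `X₂ ∩ Θ` for `X = X_{Ω₁ ⊕ Ω₂}` -/

section Product

variable {n₁ n₂ : ℕ} (Ω₁ : Matrix (Fin n₁) (Fin n₁) ℂ) (Ω₂ : Matrix (Fin n₂) (Fin n₂) ℂ)
  {Ω : Matrix (Fin (n₁ + n₂)) (Fin (n₁ + n₂)) ℂ}
  (hΩb : Ω = Matrix.reindex finSumFinEquiv finSumFinEquiv (Matrix.fromBlocks Ω₁ 0 0 Ω₂))
  (hΩ : ∀ i j, Ω i j = Ω j i) (hpos : (Matrix.of fun i j => (Ω i j).im).PosDef)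
  (Φ : (Fin (n₁ + n₂) ⊕ Fin (n₁ + n₂) → ℝ) ≃L[ℝ] (Fin (n₁ + n₂) → ℂ))
  (hΦ : ∀ v i, Φ v i = (v (Sum.inl i) : ℂ) + ∑ j, Ω i j * (v (Sum.inr j) : ℂ))
  (hΩ₁ : ∀ i j, Ω₁ i j = Ω₁ j i) (hpos₁ : (Matrix.of fun i j => (Ω₁ i j).im).PosDef)
  (Φ₁ : (Fin n₁ ⊕ Fin n₁ → ℝ) ≃L[ℝ] (Fin n₁ → ℂ))
  (hΦ₁ : ∀ v i, Φ₁ v i = (v (Sum.inl i) : ℂ) + ∑ j, Ω₁ i j * (v (Sum.inr j) : ℂ))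
  (hΩ₂ : ∀ i j, Ω₂ i j = Ω₂ j i) (hpos₂ : (Matrix.of fun i j => (Ω₂ i j).im).PosDef)
  (Φ₂ : (Fin n₂ ⊕ Fin n₂ → ℝ) ≃L[ℝ] (Fin n₂ → ℂ))
  (hΦ₂ : ∀ v i, Φ₂ v i = (v (Sum.inl i) : ℂ) + ∑ j, Ω₂ i j * (v (Sum.inr j) : ℂ))

include hΩb hpos₁ hpos₂ hΦ hΦ₁ hΦ₂ in
/-- **`π(½m) ∈ Θ ↔ π₁(½m|₁) ∈ Θ₁ ∨ π₂(½m|₂) ∈ Θ₂`** for `X = X_{Ω₁ ⊕ Ω₂}` and lattice coordinates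
`m ∈ ℤ^{2(n₁+n₂)}`: the half-period `½(Ωk + l)` restricts to the half-periods of the blocks and
`ϑ_Ω = ϑ_{Ω₁} · ϑ_{Ω₂}` ("`Θ = (Θ₁ × A₂) ∪ (A₁ × Θ₂)`").
[cite: Grushevsky2012SchottkyProblem, §5 (held p0011)] [cite: FarkasGrushevskySalvatimanni2021, §2 (p0006) and §4 (p0011)] -/
theorem proj_half_mem_thetaDivisor_blockDiag_iff (m : Fin (n₁ + n₂) ⊕ Fin (n₁ + n₂) → ℤ) :
    proj Φ (fun i ↦ (m i : ℝ) / 2) ∈ thetaDivisor Ω hΩ hpos Φ hΦ ↔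
      proj Φ₁ (fun s ↦ (m (Sum.map (Fin.castAdd n₂) (Fin.castAdd n₂) s) : ℝ) / 2) ∈
          thetaDivisor Ω₁ hΩ₁ hpos₁ Φ₁ hΦ₁ ∨
        proj Φ₂ (fun s ↦ (m (Sum.map (Fin.natAdd n₁) (Fin.natAdd n₁) s) : ℝ) / 2) ∈
          thetaDivisor Ω₂ hΩ₂ hpos₂ Φ₂ hΦ₂ := by
  obtain ⟨c₁, hc₁, hY₁⟩ := exists_pos_mul_sum_sq_le_of_posDef_im Ω₁ hpos₁
  obtain ⟨c₂, hc₂, hY₂⟩ := exists_pos_mul_sum_sq_le_of_posDef_im Ω₂ hpos₂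
  rw [proj_half_eq_cover Ω Φ hΦ, proj_half_eq_cover Ω₁ Φ₁ hΦ₁, proj_half_eq_cover Ω₂ Φ₂ hΦ₂,
    cover_mem_thetaDivisor_iff, cover_mem_thetaDivisor_iff, cover_mem_thetaDivisor_iff,
    riemannTheta_blockDiag hΩb hc₁ hc₂ hY₁ hY₂, mul_eq_zero,
    halfPeriod_restrict_fst Ω₁ Ω₂ hΩb, halfPeriod_restrict_snd Ω₁ Ω₂ hΩb]
  exact Iff.rfl

include hΩb hpos₁ hpos₂ hΦ hΦ₁ hΦ₂ in
/-- **`A[2] ∩ Θ = ((A₁[2] ∩ Θ₁) × A₂[2]) ∪ (A₁[2] × (A₂[2] ∩ Θ₂))` in coordinates**: a two-division point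
`x` of `X = X_{Ω₁ ⊕ Ω₂}` with `(ℤ/2ℤ)^{2(n₁+n₂)}`-coordinates `p = divisionPointsEquiv x` lies on `Θ` iff
the two-division point of `X₁` with coordinates `p|₁` lies on `Θ₁` or the one of `X₂` with coordinates
`p|₂` lies on `Θ₂`. [cite: Grushevsky2012SchottkyProblem, §5 (held p0011)]
[cite: Lange2023AbelianVarietiesComplex, §1.1.2 Prop. 1.1.14 (p0022)] -/
theorem coe_mem_thetaDivisor_blockDiag_iff_coord
    (x : (mapMatrixHom Φ Φ ((2 : ℤ) • (1 : Matrix (Fin (n₁ + n₂) ⊕ Fin (n₁ + n₂))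
      (Fin (n₁ + n₂) ⊕ Fin (n₁ + n₂)) ℤ))).ker) :
    (x : ComplexTorus Φ) ∈ thetaDivisor Ω hΩ hpos Φ hΦ ↔
      (((divisionPointsEquiv Φ₁ (two_ne_zero (α := ℤ))).symm
            (fun s ↦ divisionPointsEquiv Φ two_ne_zero x (Sum.map (Fin.castAdd n₂) (Fin.castAdd n₂) s)) :
          (mapMatrixHom Φ₁ Φ₁ ((2 : ℤ) • (1 : Matrix (Fin n₁ ⊕ Fin n₁) (Fin n₁ ⊕ Fin n₁) ℤ))).ker) :
          ComplexTorus Φ₁) ∈ thetaDivisor Ω₁ hΩ₁ hpos₁ Φ₁ hΦ₁ ∨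
      (((divisionPointsEquiv Φ₂ (two_ne_zero (α := ℤ))).symm
            (fun s ↦ divisionPointsEquiv Φ two_ne_zero x (Sum.map (Fin.natAdd n₁) (Fin.natAdd n₁) s)) :
          (mapMatrixHom Φ₂ Φ₂ ((2 : ℤ) • (1 : Matrix (Fin n₂ ⊕ Fin n₂) (Fin n₂ ⊕ Fin n₂) ℤ))).ker) :
          ComplexTorus Φ₂) ∈ thetaDivisor Ω₂ hΩ₂ hpos₂ Φ₂ hΦ₂ := by
  have h2 : (2 : ℤ) ≠ 0 := two_ne_zero
  obtain ⟨m, rfl⟩ := kerLatticeHomRestrict_surjective Φ Φ (det_smul_one_ne_zero h2) x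
  have hc : ∀ {k : ℕ} (Ψ : (Fin k ⊕ Fin k → ℝ) ≃L[ℝ] (Fin k → ℂ)) (m' : Fin k ⊕ Fin k → ℤ),
      (kerLatticeHomRestrict Ψ Ψ (det_smul_one_ne_zero h2) m' : ComplexTorus Ψ) =
        proj Ψ (fun i ↦ (m' i : ℝ) / 2) := fun Ψ m' ↦ by
    rw [coe_kerLatticeHomRestrict_smul_one Ψ h2 m']
    simp only [Int.cast_ofNat]
  have h₁ : (fun s ↦ divisionPointsEquiv Φ two_ne_zero
      (kerLatticeHomRestrict Φ Φ (det_smul_one_ne_zero h2) m) (Sum.map (Fin.castAdd n₂) (Fin.castAdd n₂) s)) =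
      divisionPointsEquiv Φ₁ two_ne_zero (kerLatticeHomRestrict Φ₁ Φ₁ (det_smul_one_ne_zero h2)
        (fun s ↦ m (Sum.map (Fin.castAdd n₂) (Fin.castAdd n₂) s))) := by
    rw [divisionPointsEquiv_kerLatticeHomRestrict, divisionPointsEquiv_kerLatticeHomRestrict]
  have h₂ : (fun s ↦ divisionPointsEquiv Φ two_ne_zero
      (kerLatticeHomRestrict Φ Φ (det_smul_one_ne_zero h2) m) (Sum.map (Fin.natAdd n₁) (Fin.natAdd n₁) s)) =
      divisionPointsEquiv Φ₂ two_ne_zero (kerLatticeHomRestrict Φ₂ Φ₂ (det_smul_one_ne_zero h2)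
        (fun s ↦ m (Sum.map (Fin.natAdd n₁) (Fin.natAdd n₁) s))) := by
    rw [divisionPointsEquiv_kerLatticeHomRestrict, divisionPointsEquiv_kerLatticeHomRestrict]
  rw [h₁, h₂, AddEquiv.symm_apply_apply, AddEquiv.symm_apply_apply, hc Φ m, hc Φ₁, hc Φ₂]
  exact proj_half_mem_thetaDivisor_blockDiag_iff Ω₁ Ω₂ hΩb hΩ hpos Φ hΦ hΩ₁ hpos₁ Φ₁ hΦ₁ hΩ₂ hpos₂ Φ₂
    hΦ₂ m

include hΩb hpos₁ hpos₂ hΦ hΦ₁ hΦ₂ in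
/-- **The number of two-division points on the theta divisor of a decomposable p.p.a.v.**
`(X, Θ) = (X₁, Θ₁) × (X₂, Θ₂)`, `X = X_{Ω₁ ⊕ Ω₂}`:
`#(X₂ ∩ Θ) = a · 4^{n₂} + 4^{n₁} · b − a · b` with `a = #(X₁[2] ∩ Θ₁)`, `b = #(X₂[2] ∩ Θ₂)` — inclusion–exclusion
on `A[2] ∩ Θ = ((A₁[2] ∩ Θ₁) × A₂[2]) ∪ (A₁[2] × (A₂[2] ∩ Θ₂))`, `#Aᵢ[2] = 4^{nᵢ}`.
[cite: Grushevsky2012SchottkyProblem, §5 (held p0011)] [cite: Lange2023AbelianVarietiesComplex, §1.1.2 Prop. 1.1.14 and §2.3.4 Prop. 2.3.15] -/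
theorem natCard_twoTorsion_inter_thetaDivisor_blockDiag :
    Nat.card {x : (mapMatrixHom Φ Φ ((2 : ℤ) • (1 : Matrix (Fin (n₁ + n₂) ⊕ Fin (n₁ + n₂))
        (Fin (n₁ + n₂) ⊕ Fin (n₁ + n₂)) ℤ))).ker // (x : ComplexTorus Φ) ∈ thetaDivisor Ω hΩ hpos Φ hΦ} =
      Nat.card {y : (mapMatrixHom Φ₁ Φ₁ ((2 : ℤ) • (1 : Matrix (Fin n₁ ⊕ Fin n₁) (Fin n₁ ⊕ Fin n₁) ℤ))).ker //
            (y : ComplexTorus Φ₁) ∈ thetaDivisor Ω₁ hΩ₁ hpos₁ Φ₁ hΦ₁} * 4 ^ n₂ +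
        4 ^ n₁ * Nat.card {z : (mapMatrixHom Φ₂ Φ₂ ((2 : ℤ) • (1 : Matrix (Fin n₂ ⊕ Fin n₂)
            (Fin n₂ ⊕ Fin n₂) ℤ))).ker // (z : ComplexTorus Φ₂) ∈ thetaDivisor Ω₂ hΩ₂ hpos₂ Φ₂ hΦ₂} -
        Nat.card {y : (mapMatrixHom Φ₁ Φ₁ ((2 : ℤ) • (1 : Matrix (Fin n₁ ⊕ Fin n₁) (Fin n₁ ⊕ Fin n₁) ℤ))).ker //
            (y : ComplexTorus Φ₁) ∈ thetaDivisor Ω₁ hΩ₁ hpos₁ Φ₁ hΦ₁} *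
          Nat.card {z : (mapMatrixHom Φ₂ Φ₂ ((2 : ℤ) • (1 : Matrix (Fin n₂ ⊕ Fin n₂)
            (Fin n₂ ⊕ Fin n₂) ℤ))).ker // (z : ComplexTorus Φ₂) ∈ thetaDivisor Ω₂ hΩ₂ hpos₂ Φ₂ hΦ₂} := by
  classical
  have h2 : (2 : ℤ) ≠ 0 := two_ne_zero
  -- the predicates "`the two-division point with coordinates q lies on Θᵢ`"
  obtain ⟨P₁, hP₁⟩ : ∃ P₁ : ((Fin n₁ ⊕ Fin n₁) → ZMod (2 : ℤ).natAbs) → Prop, P₁ = fun q ↦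
      (((divisionPointsEquiv Φ₁ h2).symm q : (mapMatrixHom Φ₁ Φ₁ ((2 : ℤ) • (1 : Matrix (Fin n₁ ⊕ Fin n₁)
        (Fin n₁ ⊕ Fin n₁) ℤ))).ker) : ComplexTorus Φ₁) ∈ thetaDivisor Ω₁ hΩ₁ hpos₁ Φ₁ hΦ₁ := ⟨_, rfl⟩
  obtain ⟨P₂, hP₂⟩ : ∃ P₂ : ((Fin n₂ ⊕ Fin n₂) → ZMod (2 : ℤ).natAbs) → Prop, P₂ = fun q ↦
      (((divisionPointsEquiv Φ₂ h2).symm q : (mapMatrixHom Φ₂ Φ₂ ((2 : ℤ) • (1 : Matrix (Fin n₂ ⊕ Fin n₂)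
        (Fin n₂ ⊕ Fin n₂) ℤ))).ker) : ComplexTorus Φ₂) ∈ thetaDivisor Ω₂ hΩ₂ hpos₂ Φ₂ hΦ₂ := ⟨_, rfl⟩
  -- `#(Xᵢ[2] ∩ Θᵢ) = #Pᵢ`
  have ha : Nat.card {y : (mapMatrixHom Φ₁ Φ₁ ((2 : ℤ) • (1 : Matrix (Fin n₁ ⊕ Fin n₁)
      (Fin n₁ ⊕ Fin n₁) ℤ))).ker // (y : ComplexTorus Φ₁) ∈ thetaDivisor Ω₁ hΩ₁ hpos₁ Φ₁ hΦ₁} =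
      Nat.card {q // P₁ q} :=
    Nat.card_congr ((divisionPointsEquiv Φ₁ h2).toEquiv.subtypeEquiv fun y ↦ by
      simp only [hP₁, AddEquiv.toEquiv_eq_coe, AddEquiv.coe_toEquiv, AddEquiv.symm_apply_apply])
  have hb : Nat.card {z : (mapMatrixHom Φ₂ Φ₂ ((2 : ℤ) • (1 : Matrix (Fin n₂ ⊕ Fin n₂)
      (Fin n₂ ⊕ Fin n₂) ℤ))).ker // (z : ComplexTorus Φ₂) ∈ thetaDivisor Ω₂ hΩ₂ hpos₂ Φ₂ hΦ₂} =
      Nat.card {q // P₂ q} :=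
    Nat.card_congr ((divisionPointsEquiv Φ₂ h2).toEquiv.subtypeEquiv fun z ↦ by
      simp only [hP₂, AddEquiv.toEquiv_eq_coe, AddEquiv.coe_toEquiv, AddEquiv.symm_apply_apply])
  -- `#(X[2] ∩ Θ) = #{p ∣ P₁ (p|₁) ∨ P₂ (p|₂)} = #{(u, v) ∣ P₁ u ∨ P₂ v}`
  obtain ⟨E, hE⟩ := exists_blockSplit n₁ n₂ (ZMod (2 : ℤ).natAbs)
  have hX : Nat.card {x : (mapMatrixHom Φ Φ ((2 : ℤ) • (1 : Matrix (Fin (n₁ + n₂) ⊕ Fin (n₁ + n₂))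
      (Fin (n₁ + n₂) ⊕ Fin (n₁ + n₂)) ℤ))).ker // (x : ComplexTorus Φ) ∈ thetaDivisor Ω hΩ hpos Φ hΦ} =
      Nat.card {uv : ((Fin n₁ ⊕ Fin n₁) → ZMod (2 : ℤ).natAbs) × ((Fin n₂ ⊕ Fin n₂) → ZMod (2 : ℤ).natAbs) //
        P₁ uv.1 ∨ P₂ uv.2} := by
    refine Nat.card_congr (((divisionPointsEquiv Φ h2).toEquiv.trans E).subtypeEquiv fun x ↦ ?_)
    rw [coe_mem_thetaDivisor_blockDiag_iff_coord Ω₁ Ω₂ hΩb hΩ hpos Φ hΦ hΩ₁ hpos₁ Φ₁ hΦ₁ hΩ₂ hpos₂ Φ₂ hΦ₂ x,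
      Equiv.trans_apply, (hE _).1, (hE _).2, hP₁, hP₂]
    rfl
  -- `#Uᵢ = #Xᵢ[2] = 4^{nᵢ}`
  have hU₁ : Fintype.card ((Fin n₁ ⊕ Fin n₁) → ZMod (2 : ℤ).natAbs) = 4 ^ n₁ := by
    rw [← Nat.card_eq_fintype_card, ← Nat.card_congr (divisionPointsEquiv Φ₁ h2).toEquiv,
      natCard_twoTorsion Φ₁]
  have hU₂ : Fintype.card ((Fin n₂ ⊕ Fin n₂) → ZMod (2 : ℤ).natAbs) = 4 ^ n₂ := by
    rw [← Nat.card_eq_fintype_card, ← Nat.card_congr (divisionPointsEquiv Φ₂ h2).toEquiv,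
      natCard_twoTorsion Φ₂]
  rw [hX, natCard_prod_or, ha, hb, hU₁, hU₂]

end Product

/-! ### Validation instances: `E_τ × X₂'` and `E_{τ₁} × E_{τ₂}` -/

section EllipticFactor

variable {n₂ : ℕ} (Ω₁ : Matrix (Fin 1) (Fin 1) ℂ) (Ω₂ : Matrix (Fin n₂) (Fin n₂) ℂ)
  {Ω : Matrix (Fin (1 + n₂)) (Fin (1 + n₂)) ℂ}
  (hΩb : Ω = Matrix.reindex finSumFinEquiv finSumFinEquiv (Matrix.fromBlocks Ω₁ 0 0 Ω₂))
  (hΩ : ∀ i j, Ω i j = Ω j i) (hpos : (Matrix.of fun i j => (Ω i j).im).PosDef)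
  (Φ : (Fin (1 + n₂) ⊕ Fin (1 + n₂) → ℝ) ≃L[ℝ] (Fin (1 + n₂) → ℂ))
  (hΦ : ∀ v i, Φ v i = (v (Sum.inl i) : ℂ) + ∑ j, Ω i j * (v (Sum.inr j) : ℂ))
  (hΩ₁ : ∀ i j, Ω₁ i j = Ω₁ j i) (hpos₁ : (Matrix.of fun i j => (Ω₁ i j).im).PosDef)
  (Φ₁ : (Fin 1 ⊕ Fin 1 → ℝ) ≃L[ℝ] (Fin 1 → ℂ))
  (hΦ₁ : ∀ v i, Φ₁ v i = (v (Sum.inl i) : ℂ) + ∑ j, Ω₁ i j * (v (Sum.inr j) : ℂ))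
  (hΩ₂ : ∀ i j, Ω₂ i j = Ω₂ j i) (hpos₂ : (Matrix.of fun i j => (Ω₂ i j).im).PosDef)
  (Φ₂ : (Fin n₂ ⊕ Fin n₂ → ℝ) ≃L[ℝ] (Fin n₂ → ℂ))
  (hΦ₂ : ∀ v i, Φ₂ v i = (v (Sum.inl i) : ℂ) + ∑ j, Ω₂ i j * (v (Sum.inr j) : ℂ))

include Ω₁ hΩb hpos₁ hpos₂ hΦ hΩ₁ Φ₁ hΦ₁ hΦ₂ in
/-- **`X = E_τ × X₂'` (product principal polarisation): `#(X₂ ∩ Θ) = 4^{n₂} + 3 · #(X₂'[2] ∩ Θ₂)`** —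
the count `a·4^{n₂} + 4·b − a·b` with `a = #(E_τ[2] ∩ Θ_τ) = 1` (`natCard_twoTorsion_inter_thetaDivisor_fin_one`).
[cite: Grushevsky2012SchottkyProblem, §5 (held p0011)] [cite: Lange2023AbelianVarietiesComplex, §2.3.4 Prop. 2.3.15] -/
theorem natCard_twoTorsion_inter_thetaDivisor_elliptic_blockDiag :
    Nat.card {x : (mapMatrixHom Φ Φ ((2 : ℤ) • (1 : Matrix (Fin (1 + n₂) ⊕ Fin (1 + n₂))
        (Fin (1 + n₂) ⊕ Fin (1 + n₂)) ℤ))).ker // (x : ComplexTorus Φ) ∈ thetaDivisor Ω hΩ hpos Φ hΦ} =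
      4 ^ n₂ + 3 * Nat.card {z : (mapMatrixHom Φ₂ Φ₂ ((2 : ℤ) • (1 : Matrix (Fin n₂ ⊕ Fin n₂)
            (Fin n₂ ⊕ Fin n₂) ℤ))).ker // (z : ComplexTorus Φ₂) ∈ thetaDivisor Ω₂ hΩ₂ hpos₂ Φ₂ hΦ₂} := by
  have hle : Nat.card {z : (mapMatrixHom Φ₂ Φ₂ ((2 : ℤ) • (1 : Matrix (Fin n₂ ⊕ Fin n₂)
      (Fin n₂ ⊕ Fin n₂) ℤ))).ker // (z : ComplexTorus Φ₂) ∈ thetaDivisor Ω₂ hΩ₂ hpos₂ Φ₂ hΦ₂} ≤ 4 ^ n₂ := by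
    have hfin : Finite (mapMatrixHom Φ₂ Φ₂ ((2 : ℤ) • (1 : Matrix (Fin n₂ ⊕ Fin n₂)
        (Fin n₂ ⊕ Fin n₂) ℤ))).ker :=
      Nat.finite_of_card_ne_zero (by rw [natCard_twoTorsion Φ₂]; positivity)
    rw [← natCard_twoTorsion Φ₂]
    exact Nat.card_le_card_of_injective Subtype.val Subtype.val_injective
  rw [natCard_twoTorsion_inter_thetaDivisor_blockDiag Ω₁ Ω₂ hΩb hΩ hpos Φ hΦ hΩ₁ hpos₁ Φ₁ hΦ₁ hΩ₂ hpos₂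
    Φ₂ hΦ₂, natCard_twoTorsion_inter_thetaDivisor_fin_one Ω₁ hΩ₁ hpos₁ Φ₁ hΦ₁, pow_one, one_mul, one_mul]
  omega

end EllipticFactor

section EllipticProduct

variable (Ω₁ : Matrix (Fin 1) (Fin 1) ℂ) (Ω₂ : Matrix (Fin 1) (Fin 1) ℂ)
  {Ω : Matrix (Fin (1 + 1)) (Fin (1 + 1)) ℂ}
  (hΩb : Ω = Matrix.reindex finSumFinEquiv finSumFinEquiv (Matrix.fromBlocks Ω₁ 0 0 Ω₂))
  (hΩ : ∀ i j, Ω i j = Ω j i) (hpos : (Matrix.of fun i j => (Ω i j).im).PosDef)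
  (Φ : (Fin (1 + 1) ⊕ Fin (1 + 1) → ℝ) ≃L[ℝ] (Fin (1 + 1) → ℂ))
  (hΦ : ∀ v i, Φ v i = (v (Sum.inl i) : ℂ) + ∑ j, Ω i j * (v (Sum.inr j) : ℂ))
  (hΩ₁ : ∀ i j, Ω₁ i j = Ω₁ j i) (hpos₁ : (Matrix.of fun i j => (Ω₁ i j).im).PosDef)
  (Φ₁ : (Fin 1 ⊕ Fin 1 → ℝ) ≃L[ℝ] (Fin 1 → ℂ))
  (hΦ₁ : ∀ v i, Φ₁ v i = (v (Sum.inl i) : ℂ) + ∑ j, Ω₁ i j * (v (Sum.inr j) : ℂ))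
  (hΩ₂ : ∀ i j, Ω₂ i j = Ω₂ j i) (hpos₂ : (Matrix.of fun i j => (Ω₂ i j).im).PosDef)
  (Φ₂ : (Fin 1 ⊕ Fin 1 → ℝ) ≃L[ℝ] (Fin 1 → ℂ))
  (hΦ₂ : ∀ v i, Φ₂ v i = (v (Sum.inl i) : ℂ) + ∑ j, Ω₂ i j * (v (Sum.inr j) : ℂ))

include Ω₁ Ω₂ hΩb hpos₁ hpos₂ hΦ hΩ₁ hΩ₂ Φ₁ Φ₂ hΦ₁ hΦ₂ in
/-- **`E_{τ₁} × E_{τ₂}`: exactly `7` of the `16` two-division points lie on `Θ = E₁ × {p₂} ∪ {p₁} × E₂`**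
(`1·4 + 4·1 − 1·1 = 7`: the `6` odd points and the even point `(p₁, p₂) = Sing Θ`) — the block-diagonal twin
of `natCard_twoTorsion_inter_thetaDivisor_diagonal_fin_two`.
[cite: Grushevsky2012SchottkyProblem, §5 (held p0011)] [cite: FarkasGrushevskySalvatimanni2021, §4 (p0011)] -/
theorem natCard_twoTorsion_inter_thetaDivisor_elliptic_prod :
    Nat.card {x : (mapMatrixHom Φ Φ ((2 : ℤ) • (1 : Matrix (Fin (1 + 1) ⊕ Fin (1 + 1))
        (Fin (1 + 1) ⊕ Fin (1 + 1)) ℤ))).ker // (x : ComplexTorus Φ) ∈ thetaDivisor Ω hΩ hpos Φ hΦ} = 7 := by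
  rw [natCard_twoTorsion_inter_thetaDivisor_elliptic_blockDiag Ω₁ Ω₂ hΩb hΩ hpos Φ hΦ hΩ₁ hpos₁ Φ₁ hΦ₁
    hΩ₂ hpos₂ Φ₂ hΦ₂, natCard_twoTorsion_inter_thetaDivisor_fin_one Ω₂ hΩ₂ hpos₂ Φ₂ hΦ₂]
  norm_num

end EllipticProduct

end ComplexTorus

end Literature.Geometry.Kaehler

end
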